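import Summits.QuantumFields.YangMills.Theorems.BalabanUVNodesN15KingModelFreeRGSemigroupKing
import HarnessLib

/-!
# BalabanUVNodes ∕ N15 — THE KING-MODEL RUNG, FREE-FIELD EDITION (PART Τ-j₃): **THE RENORMALIZATION TRANSFORMATION PRESERVES THE PARTITION FUNCTION
# ON ALL DENSITIES** — `∫dψ (T_{a,L}F)(ψ) = ∫dφ F(φ)` for every integrable `F`, generically (`integral_blockSpinOp`, any block map `Q`) and BY NAME for King's
# `T_{a_k,L^k}` on the tori `Π ℤ∕(M₀L^m)` (`kingRG_preserves_integral`); positivity `F ≥ 0 ⇒ T F ≥ 0` ([King1986] (2.5)∕(2.13)∕(3.14): the partition function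
# `Z^ε = ∫e^{−S^{(0)}} = ∫dφ_k e^{−S^{(k)}}` is the same at every level; Track A, DAG node N15 = NE2; FAN-OUT v1.1 §N15 s3 «KING-MODEL RUNG»; regen R453 (b))

HONEST FRAMING.  Count-neutral (cell `pub-ymgap`, seat `pub-ymgap-dag-n15-e` g20; `--supports stmt-QuantumFields-27366 --as helper` = K3⁸
`SpineGivenEndpointR13SepCoPHV`).  Finite-dimensional Gaussian calculus with Lebesgue measure (Mathlib) + part Τ-i₃'s King objects.  WHY: King's
effective actions are DEFINED by `e^{−S^{(k)}} = T_{a_k,L^k}e^{−S^{(0)}}` ((2.13)) with the normalisation `N` of (2.15) chosen so that `T` preserves total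
mass; hence `Z^{ε} = ∫(dA)(dφ)e^{−S^ε}` ((2.5)) equals `∫dφ_k e^{−S^{(k)}(φ_k)}` for every `k` — the identity behind (3.3)–(3.4)∕(3.14), where Theorem 3.1 bounds
`Z^{ε_K}` by the level-`k` small-field integral of `e^{−S^{(k),1}}`.  Parts Τ-i₁ (`gaussNorm_bsEff_mul`, `blockSpin_density`) proved mass preservation for
GAUSSIAN densities; part Τ-j₂ (`kingRG_semigroup`) the composition law on all densities.  THIS FILE proves MASS PRESERVATION ON ALL INTEGRABLE DENSITIES:
* §1 generic (`Q : Matrix κ ι ℝ` arbitrary, `a > 0`): `integrable_blockSpinOp_integrand` (the joint integrand `e^{−½a‖ψ−Qφ‖²}F(φ)` is integrable on the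
  product — `integrable_prod_iff'`: coarse Gaussian fibres, fibre masses `√(2π∕a)^{|κ|}·|F(φ)|`), ★★ `integral_blockSpinOp`:
  `∫dψ √(a∕2π)^{|κ|}∫dφ e^{−½a‖ψ−Qφ‖²}F(φ) = ∫dφ F(φ)` (Fubini + part Τ-i₁ `integral_exp_coarseGauss`), `blockSpinOp_nonneg` (`F ≥ 0 ⇒ T F ≥ 0`);
* §3 (2.13) VERBATIM for the free field: `kingFreeS_eq_neg_log_blockSpin` — `S_m^{(k)} = −ln[T_{a_k,L^k}e^{−S_{m+k}^{(0)}}]` (`k ≥ 1`) and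
  `kingFreeS_succ_eq_neg_log_blockSpin` — `S_m^{(k+1)} = −ln[T_{a,L}e^{−S_{m+1}^{(k)}}]` (every `k ≥ 0`): part Τ-i₃'s identities read through `ln`;
* §2 King BY NAME: ★★ `kingRG_preserves_integral` — for every `k`, depth `m` and integrable `F` on the fields of `Π ℤ∕(M₀L^{m+k})`,
  `∫dψ N_{a_k}∫dφ e^{−(a_k∕2)‖ψ − Q̃_kφ‖²}F(φ) = ∫dφ F(φ)` (`Q̃_k = kingBlockAvgK`, any constant `a_k > 0`; in particular King's `aK a L k`), and
  `kingRG_nonneg`.  With part Τ-i₃ (`e^{−S_m^{(k)}} = T_{a_k,L^k}e^{−S_{m+k}^{(0)}}`) this re-derives part Τ-g₁'s `∫e^{−S^{(k),1}} = 1` from `∫e^{−S^{(0)}} = 1`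
  for the free field, and gives `∫ρ_k = ∫ρ₀` for ANY integrable bare density `ρ₀` (interacting included, none constructed here).
HONEST SCOPE: `A = 0`, one-component scalar, King's flat mean (2.10); Bałaban's covariant `Q(A)` ∕ the vector-field transformation are not touched; nothing
about `Z^ε`'s value or its limit.  NOT Bałaban's objects; NOT a node discharge; nothing continuum-YM ∕ ℝ⁴ ∕ OS ∕ mass-gap ∕ Clay.  0 `sorry`; NO definition;
standard axioms.  READING NOTE (ref-K READ-340, carried): the identities hold under `0 < a` (resp. `0 < a_k`: `L ≥ 2`, `a > 0`, `k ≥ 1`) and `Integrable F`;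
for a non-integrable `F` both Bochner sides are junk.
Locators: [King1986] (2.4)–(2.6) p.652, (2.13)–(2.15) p.653, (3.3)–(3.4) p.655, (3.14) p.657; [Balaban1982Higgs1] §2 pp.608–612.
-/

noncomputable section

namespace Summit.QuantumFields.YangMills.BalabanUVNodes.N15KingModelRung.FreeField

open Real Finset Matrix MeasureTheory
open Literature.MathematicalPhysics.QuantumFieldTheory.Balaban1983to89.B5Prop11Plancherel (Tor)
open Literature.MathematicalPhysics.QuantumFieldTheory.King1986 (aK aK_pos)
open Literature.MathematicalPhysics.QuantumFieldTheory.King1986.Torus (Qmat torCongr)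

/-! ## §1 Generic: `∫ T_a^{Q}F = ∫ F` for every integrable `F` -/

section Generic

variable {κ ι : Type*} [Fintype κ] [Fintype ι] [DecidableEq κ] {a : ℝ} (Q : Matrix κ ι ℝ)

omit [DecidableEq κ] in
/-- The joint integrand `(ψ, φ) ↦ e^{−½a‖ψ−Qφ‖²}F(φ)` is a.e.-strongly measurable on the product. [folklore] -/
theorem aestronglyMeasurable_blockSpinOp_integrand {F : (ι → ℝ) → ℝ} (hF : Integrable F) :
    AEStronglyMeasurable (fun q : (κ → ℝ) × (ι → ℝ) =>
        Real.exp (-(1 / 2 : ℝ) * (a * ((q.1 - Q *ᵥ q.2) ⬝ᵥ (q.1 - Q *ᵥ q.2)))) * F q.2)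
      ((volume : Measure (κ → ℝ)).prod (volume : Measure (ι → ℝ))) := by
  have hc : Continuous fun q : (κ → ℝ) × (ι → ℝ) => Real.exp (-(1 / 2 : ℝ) * (a * ((q.1 - Q *ᵥ q.2) ⬝ᵥ (q.1 - Q *ᵥ q.2)))) := by
    simp only [dotProduct, Matrix.mulVec, Pi.sub_apply]
    fun_prop
  exact hc.aestronglyMeasurable.mul hF.aestronglyMeasurable.comp_snd

/-- **The joint integrand is integrable on the product** (`integrable_prod_iff'`: for each `φ` the coarse Gaussian fibre is integrable; the fibre masses are
`√(2π∕a)^{|κ|}·|F(φ)|`). [folklore] -/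
theorem integrable_blockSpinOp_integrand (ha : 0 < a) {F : (ι → ℝ) → ℝ} (hF : Integrable F) :
    Integrable (fun q : (κ → ℝ) × (ι → ℝ) =>
        Real.exp (-(1 / 2 : ℝ) * (a * ((q.1 - Q *ᵥ q.2) ⬝ᵥ (q.1 - Q *ᵥ q.2)))) * F q.2)
      ((volume : Measure (κ → ℝ)).prod (volume : Measure (ι → ℝ))) := by
  rw [integrable_prod_iff' (aestronglyMeasurable_blockSpinOp_integrand Q hF)]
  refine ⟨Filter.Eventually.of_forall fun φ => (integrable_exp_coarseGauss ha (Q *ᵥ φ)).mul_const (F φ), ?_⟩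
  have h := hF.norm.const_mul (Real.sqrt (2 * π / a) ^ Fintype.card κ)
  refine h.congr (Filter.Eventually.of_forall fun φ => ?_)
  beta_reduce
  have hpt : ∀ ψ : κ → ℝ, ‖Real.exp (-(1 / 2 : ℝ) * (a * ((ψ - Q *ᵥ φ) ⬝ᵥ (ψ - Q *ᵥ φ)))) * F φ‖
      = Real.exp (-(1 / 2 : ℝ) * (a * ((ψ - Q *ᵥ φ) ⬝ᵥ (ψ - Q *ᵥ φ)))) * ‖F φ‖ := by
    intro ψ
    rw [norm_mul, Real.norm_eq_abs, abs_of_pos (Real.exp_pos _)]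
  simp_rw [hpt]
  rw [integral_mul_const, integral_exp_coarseGauss ha]

/-- ★★ **THE BLOCK-SPIN TRANSFORMATION PRESERVES TOTAL MASS ON ALL DENSITIES**: for `a > 0`, any block map `Q` and every integrable `F`,
`∫dψ √(a∕2π)^{|κ|}∫dφ e^{−½a‖ψ−Qφ‖²}F(φ) = ∫dφ F(φ)` — King's normalisation `N` of (2.15)∕`exp E₀` of (2.6) makes `Z^ε = ∫e^{−S^{(0)}} = ∫dφ_k e^{−S^{(k)}}`
((2.5), (2.13), (3.14)) for the interacting densities as well as the free ones. [cite: King1986, (2.4)–(2.6) p.652, (2.13)–(2.15) p.653, (3.14) p.657] -/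
theorem integral_blockSpinOp (ha : 0 < a) {F : (ι → ℝ) → ℝ} (hF : Integrable F) :
    ∫ ψ : κ → ℝ, Real.sqrt (a / (2 * π)) ^ Fintype.card κ
        * ∫ φ : ι → ℝ, Real.exp (-(1 / 2 : ℝ) * (a * ((ψ - Q *ᵥ φ) ⬝ᵥ (ψ - Q *ᵥ φ)))) * F φ
      = ∫ φ : ι → ℝ, F φ := by
  set H : (κ → ℝ) × (ι → ℝ) → ℝ := fun q =>
      Real.exp (-(1 / 2 : ℝ) * (a * ((q.1 - Q *ᵥ q.2) ⬝ᵥ (q.1 - Q *ᵥ q.2)))) * F q.2 with hH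
  have hHi : Integrable H ((volume : Measure (κ → ℝ)).prod (volume : Measure (ι → ℝ))) :=
    integrable_blockSpinOp_integrand Q ha hF
  have hswap : ∫ ψ : κ → ℝ, ∫ φ : ι → ℝ, H (ψ, φ) = ∫ φ : ι → ℝ, ∫ ψ : κ → ℝ, H (ψ, φ) := by
    rw [← integral_prod H hHi, integral_prod_symm H hHi]
  have hinner : ∀ φ : ι → ℝ, ∫ ψ : κ → ℝ, H (ψ, φ) = Real.sqrt (2 * π / a) ^ Fintype.card κ * F φ := by
    intro φ
    simp only [hH]
    rw [integral_mul_const, integral_exp_coarseGauss ha]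
  have hkey : Real.sqrt (a / (2 * π)) ^ Fintype.card κ * Real.sqrt (2 * π / a) ^ Fintype.card κ = 1 := by
    rw [← mul_pow, sqrt_div_mul_sqrt_div ha, one_pow]
  rw [integral_const_mul]
  change Real.sqrt (a / (2 * π)) ^ Fintype.card κ * ∫ ψ : κ → ℝ, ∫ φ : ι → ℝ, H (ψ, φ) = _
  rw [hswap]
  simp_rw [hinner]
  rw [integral_const_mul, ← mul_assoc, hkey, one_mul]

omit [DecidableEq κ] in
/-- **Positivity**: `F ≥ 0 ⇒ T_a^{Q}F ≥ 0` pointwise. [folklore] -/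
theorem blockSpinOp_nonneg (a : ℝ) {F : (ι → ℝ) → ℝ} (hF : ∀ φ, 0 ≤ F φ) (ψ : κ → ℝ) :
    0 ≤ Real.sqrt (a / (2 * π)) ^ Fintype.card κ
        * ∫ φ : ι → ℝ, Real.exp (-(1 / 2 : ℝ) * (a * ((ψ - Q *ᵥ φ) ⬝ᵥ (ψ - Q *ᵥ φ)))) * F φ := by
  exact mul_nonneg (pow_nonneg (Real.sqrt_nonneg _) _) (integral_nonneg fun φ => mul_nonneg (Real.exp_pos _).le (hF φ))

end Generic

/-! ## §2 King by name: `T_{a_k,L^k}` on `Π ℤ∕(M₀L^m)` preserves `∫` and positivity -/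

section King

variable {d : ℕ} (L : ℕ) [NeZero L] (M₀ : ℕ) [NeZero M₀]

/-- ★★ **KING'S `T_{a,L^k}` PRESERVES THE PARTITION FUNCTION ON ALL DENSITIES**: for every `k`, depth `m`, Gaussian constant `a > 0` and integrable `F`
on the fields of `Π ℤ∕(M₀L^{m+k})`, `∫dψ √(a∕2π)^{|T₁^{(k)}|}∫dφ e^{−(a∕2)‖ψ − Q̃_kφ‖²}F(φ) = ∫dφ F(φ)` (`Q̃_k = kingBlockAvgK` the rescaled `L^k`-block mean):
`Z^ε = ∫e^{−S^{(0)}} = ∫dφ_k e^{−S^{(k)}}` for King's `S^{(k)} = −ln T_{a_k,L^k}e^{−S^{(0)}}` of ANY model. [cite: King1986, (2.5)–(2.6) p.652, (2.13)–(2.15) p.653, (3.14) p.657] -/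
theorem kingRG_preserves_integral {a : ℝ} (ha : 0 < a) (m k : ℕ)
    {F : (Tor (cubeSide (d := d) M₀ L (m + k)) → ℝ) → ℝ} (hF : Integrable F) :
    ∫ ψ : Tor (cubeSide (d := d) M₀ L m) → ℝ, Real.sqrt (a / (2 * π)) ^ Fintype.card (Tor (cubeSide (d := d) M₀ L m))
        * ∫ φ : Tor (cubeSide (d := d) M₀ L (m + k)) → ℝ,
            Real.exp (-(1 / 2 : ℝ) * (a * ((ψ - kingBlockAvgK L M₀ m k φ) ⬝ᵥ (ψ - kingBlockAvgK L M₀ m k φ)))) * F φ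
      = ∫ φ : Tor (cubeSide (d := d) M₀ L (m + k)) → ℝ, F φ := by
  simp only [kingBlockAvgK_eq_mulVec]
  exact integral_blockSpinOp _ ha hF

/-- The same at King's constant `a_k = aK a L k` (`k ≥ 1`). [cite: King1986, (2.13)–(2.15) p.653] -/
theorem kingRG_preserves_integral_aK {a : ℝ} (ha : 0 < a) (hL : 2 ≤ L) (m : ℕ) {k : ℕ} (hk : 1 ≤ k)
    {F : (Tor (cubeSide (d := d) M₀ L (m + k)) → ℝ) → ℝ} (hF : Integrable F) :
    ∫ ψ : Tor (cubeSide (d := d) M₀ L m) → ℝ, Real.sqrt (aK a L k / (2 * π)) ^ Fintype.card (Tor (cubeSide (d := d) M₀ L m))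
        * ∫ φ : Tor (cubeSide (d := d) M₀ L (m + k)) → ℝ,
            Real.exp (-(1 / 2 : ℝ) * (aK a L k * ((ψ - kingBlockAvgK L M₀ m k φ) ⬝ᵥ (ψ - kingBlockAvgK L M₀ m k φ)))) * F φ
      = ∫ φ : Tor (cubeSide (d := d) M₀ L (m + k)) → ℝ, F φ :=
  kingRG_preserves_integral L M₀ (aK_pos ha (by exact_mod_cast (show 1 < L by omega)) hk) m k hF

/-- **Positivity of King's transformation**: `F ≥ 0 ⇒ T_{a,L^k}F ≥ 0`. [folklore] -/
theorem kingRG_nonneg (a : ℝ) (m k : ℕ) {F : (Tor (cubeSide (d := d) M₀ L (m + k)) → ℝ) → ℝ} (hF : ∀ φ, 0 ≤ F φ)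
    (ψ : Tor (cubeSide (d := d) M₀ L m) → ℝ) :
    0 ≤ Real.sqrt (a / (2 * π)) ^ Fintype.card (Tor (cubeSide (d := d) M₀ L m))
        * ∫ φ : Tor (cubeSide (d := d) M₀ L (m + k)) → ℝ,
            Real.exp (-(1 / 2 : ℝ) * (a * ((ψ - kingBlockAvgK L M₀ m k φ) ⬝ᵥ (ψ - kingBlockAvgK L M₀ m k φ)))) * F φ := by
  exact mul_nonneg (pow_nonneg (Real.sqrt_nonneg _) _) (integral_nonneg fun φ => mul_nonneg (Real.exp_pos _).le (hF φ))

end King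

/-! ## §3 (2.13) verbatim for the free field: `S^{(k)} = −ln T_{a_k,L^k} e^{−S^{(0)}}` -/

section FreeField

variable {d : ℕ} {L : ℕ} [NeZero L] {M₀ : ℕ} [NeZero M₀]

/-- ★ **KING'S DEFINITION (2.13) BY NAME FOR THE FREE FIELD**: part Τ-e's effective action IS minus the logarithm of the `k`-fold renormalization transform of
the bare density — `S_m^{(k)}(φ′) = −ln[ N_{a_k}∫dφ e^{−(a_k∕2)‖φ′ − Q̃_kφ‖²} e^{−S_{m+k}^{(0)}(φ)} ]` (`k ≥ 1`; part Τ-i₃ `exp_neg_kingFreeS_eq_blockSpin_bare` read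
through `ln`). [cite: King1986, (2.13) p.653, (3.14) p.657] -/
theorem kingFreeS_eq_neg_log_blockSpin {a msq : ℝ} (ha : 0 < a) (hL : 2 ≤ L) (hmsq : 0 < msq) (m : ℕ) {k : ℕ} (hk : 1 ≤ k)
    (φ' : Tor (cubeSide (d := d) M₀ L m) → ℝ) :
    kingFreeS L M₀ a msq m k φ'
      = -Real.log (Real.sqrt (aK a L k / (2 * π)) ^ Fintype.card (Tor (cubeSide (d := d) M₀ L m))
          * ∫ φ : Tor (cubeSide (d := d) M₀ L (m + k)) → ℝ,
              Real.exp (-(1 / 2 : ℝ) * (aK a L k * ((φ' - kingBlockAvgK L M₀ m k φ) ⬝ᵥ (φ' - kingBlockAvgK L M₀ m k φ))))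
                * Real.exp (-kingFreeS L M₀ a msq (m + k) 0 φ)) := by
  rw [← exp_neg_kingFreeS_eq_blockSpin_bare ha hL hmsq m hk φ', Real.log_exp, neg_neg]

/-- … and ONE step: `S_m^{(k+1)}(φ′) = −ln[ N_a∫dφ_k e^{−(a∕2)‖φ′ − Q̃φ_k‖²} e^{−S_{m+1}^{(k)}(φ_k)} ]` for every `k ≥ 0` (part Τ-i₃ `exp_neg_kingFreeS_succ`).
[cite: King1986, (2.4) p.652, (3.14)–(3.15) p.657] -/
theorem kingFreeS_succ_eq_neg_log_blockSpin {a msq : ℝ} (ha : 0 < a) (hL : 2 ≤ L) (hmsq : 0 < msq) (m k : ℕ)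
    (φ' : Tor (cubeSide (d := d) M₀ L m) → ℝ) :
    kingFreeS L M₀ a msq m (k + 1) φ'
      = -Real.log (Real.sqrt (a / (2 * π)) ^ Fintype.card (Tor (cubeSide (d := d) M₀ L m))
          * ∫ φ : Tor (cubeSide (d := d) M₀ L (m + 1)) → ℝ,
              Real.exp (-(1 / 2 : ℝ) * (a * ((φ' - kingBlockAvg L M₀ m φ) ⬝ᵥ (φ' - kingBlockAvg L M₀ m φ))))
                * Real.exp (-kingFreeS L M₀ a msq (m + 1) k φ)) := by
  rw [← exp_neg_kingFreeS_succ ha hL hmsq m k φ', Real.log_exp, neg_neg]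

end FreeField

end Summit.QuantumFields.YangMills.BalabanUVNodes.N15KingModelRung.FreeField

end
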